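import Summits.QuantumFields.YangMills.Theorems.BalabanUVNodesN15KingModelGraphPowerCountingLowered

/-!
# BalabanUVNodes ∕ N15 — THE KING-MODEL RUNG (PART Γ-g): PROPOSITION 3.6's POWER COUNTING FOR GENERAL GRAPHS — ONE ELIMINATION ORDER PER ORDERING: the graph
# value is invariant under renumbering the vertices, certificates on a renumbered copy (`ForestCertR`), the graph-free CORES of the size ∕ `S^c` bounds (a
# per-ordering majorisation by slice products ⇒ the bounds over all assignments), and the generic assemblies with one renumbering per ordering
# (Track A, DAG node N15 = NE2; FAN-OUT v1.1 §N15 s3 «KING-MODEL RUNG … NE2's analogue DECIDED in the model»)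

HONEST FRAMING.  Count-neutral (cell `pub-ymgap`, seat `pub-ymgap-dag-n15-e` g27; `--supports stmt-QuantumFields-27366 --as helper` = K3⁸
`SpineGivenEndpointR13SepCoPHV`).  TEMPLATE LITERATURE: C. King, *The U(1) Higgs model. I. The continuum limit*, Commun. Math. Phys. **102** (1986) 649–677
[King1986], proof of Proposition 3.6, pp. 663–664.  WHY THIS FILE: parts Γ-a–Γ-f state the power counting with spanning-forest certificates on ONE numbering
of the vertices for all orderings of the lines (`ForestCert`: the tree line of vertex `i+1` reaches an earlier vertex).  King's procedure shrinks the graph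
along the Kruskal lines OF THE ORDERING — its elimination order changes with the ordering, and for graphs with cycles no single numbering serves every
ordering (the triangle: along `{a,b},{0,b},{0,a}` the vertex `a` is stripped first, along `{a,b},{0,a},{0,b}` the vertex `b`).  So the honest general form
carries ONE RENUMBERING PER ORDERING; this file supplies it (the graph value does not see vertex names), isolates the graph-free cores of parts Γ-b∕Γ-d, and
re-assembles the generic bounds; parts Γ-h∕Γ-i re-run King's theorems on it.  Generic; NOT Bałaban's `G(U)`; NOT a node discharge; nothing continuum ∕
ℝ⁴ ∕ OS ∕ mass-gap ∕ Clay.  0 `sorry`; standard axioms.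
THE PRINT.  p. 664 [PDF 16]: *«Let x, y be the endpoints of the graph H₁ = l(1) … We then sum over y … Graphically, we have shrunk l(1) to a point in H; the
remaining vertices are summed with the constraint −n ≤ j_{l(2)} ≤ j_{l(3)} ≤ … ≤ j_{l(m)} ≤ k − 1. We continue doing this … eventually shrinking H to one
point x. … Finally, there is a sum over orderings of the lines, again depending only on n̄.»* (the vertex summed at each step is the one l(i) newly reaches —
an order determined by the ordering l).
WHAT THIS FILE PROVES.
* §1 (ns `…Graph`) `sum_comp_vperm_eq`, ★ `graphValLS_relabel` (`graphValLS ω (ρ∘src) (ρ∘tgt) P (ρ∘vtx) p = graphValLS ω src tgt P vtx p` for every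
  permutation `ρ` of the vertices); structure `ForestCertR n src tgt` (`ρ` with `ρ 0 = 0`, and a `ForestCert` on the renumbered graph); ★★
  `graphValLS_le_of_forestCertR` (part Γ-a's bound for every relabelled certificate).
* §2 (ns `…Curved`) ★★ `sum_le_of_perOrdering` (THE SIZE CORE: if `G j ≤ B·sliceProd (E^π) (j ∘ π)` for `j` monotone along `π` and the lists `E^π` have
  positive partial degrees, then `Σ_j G j ≤ B·Σ_π degConst L E^π`), ★★ `sum_lt_le_of_perOrdering` (THE `S^c` CORE: `Σ_{j : some line < n₁} G j ≤
  (L^{n₁−1}η)^γ·B·Σ_π degConst (finest-lowered E^π)`).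
* §3 ★★★ `sum_graphValLS_slices_le_R`, ★★ `sum_graphValLS_slices_lt_le_R` — parts Γ-b∕Γ-d's generic assemblies with `cert : Perm (Fin m) → ForestCertR n src tgt`
  and the lists `orderList dV e π (cert π).F`.
HONEST SCOPE.  (a) Generic; King's objects in parts Γ-h∕Γ-i.  (b) The certificates remain user data per ordering (Kruskal's forest of `π` after renumbering
the vertices in the order they are reached reproduces King's `D(H_i)`; no Kruskal construction typed); positivity of the degrees is a hypothesis (§3.5 NOT
typed).  Locators: [King1986] (3.58)–(3.59) p.663, (3.66) p.663 (foot), (3.67)–(3.70) p.664.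
-/
noncomputable section

namespace Summit.QuantumFields.YangMills.BalabanUVNodes.N15KingModelRung.Graph

open scoped BigOperators
open Finset

/-! ## §1 Relabelling the vertices; certificates after a renumbering -/

section Relabel
variable {S Λ Υ V : Type*} [Fintype S] [Fintype Λ] [Fintype Υ] [Fintype V] [DecidableEq V]

/-- re-indexing the placements along a permutation of the vertices: `Σ_σ F (σ ∘ ρ) = Σ_σ F σ`. [folklore] -/
theorem sum_comp_vperm_eq {M : Type*} [AddCommMonoid M] (ρ : Equiv.Perm V) (F : (V → S) → M) :
    ∑ σ : V → S, F (σ ∘ ⇑ρ) = ∑ σ : V → S, F σ :=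
  Equiv.sum_comp
    ({ toFun := fun σ => σ ∘ ⇑ρ, invFun := fun σ => σ ∘ ⇑ρ.symm,
       left_inv := fun σ => funext fun v => by simp only [Function.comp_apply, Equiv.apply_symm_apply],
       right_inv := fun σ => funext fun v => by simp only [Function.comp_apply, Equiv.symm_apply_apply] } :
      (V → S) ≃ (V → S)) F

/-- ★ **THE GRAPH VALUE DOES NOT SEE THE NAMES OF THE VERTICES**: renumbering the vertices by a permutation `ρ` (endpoints `ρ ∘ src`, `ρ ∘ tgt`, one-vertex
placements `ρ ∘ vtx`) leaves part Η-a's `graphValLS` unchanged. [folklore] -/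
theorem graphValLS_relabel (ρ : Equiv.Perm V) (ω : ℝ) (src tgt : Λ → V) (P : Λ → S → S → ℝ) (vtx : Υ → V) (p : Υ → S → ℝ) :
    graphValLS ω (⇑ρ ∘ src) (⇑ρ ∘ tgt) P (⇑ρ ∘ vtx) p = graphValLS ω src tgt P vtx p := by
  unfold graphValLS
  exact sum_comp_vperm_eq ρ (fun σ : V → S => ω ^ Fintype.card V * ((∏ ℓ, P ℓ (σ (src ℓ)) (σ (tgt ℓ))) * ∏ υ, p υ (σ (vtx υ))))

/-- **A SPANNING-FOREST CERTIFICATE AFTER A RENUMBERING OF THE VERTICES** (the root `0` fixed): King's shrinking procedure along an ordering strips the graph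
leaf-first in the order the Kruskal tree lines reach new points — a DIFFERENT elimination order for each ordering of the lines; part Γ-a's `ForestCert` asks
the numbering `0, …, n` itself to be such an order (`lo i ≤ i`), so for graphs with cycles the certificate of an ordering generally lives on a renumbered copy
of the graph.  (Example: the triangle on `0, a, b` along the ordering `{a,b}, {0,b}, {0,a}` strips `a` first — numbering `b = 1, a = 2`; along
`{a,b}, {0,a}, {0,b}` it strips `b` first — numbering `a = 1, b = 2`.) [cite: King1986, (3.66)–(3.67) p.664 («Graphically, we have shrunk l(1) to a point in H;
the remaining vertices are summed …»)] -/
structure ForestCertR (n : ℕ) {Λ : Type*} (src tgt : Λ → Fin (n + 1)) where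
  /-- the renumbering of the vertices -/
  ρ : Equiv.Perm (Fin (n + 1))
  /-- … fixing the root -/
  ρ_zero : ρ 0 = 0
  /-- the certificate on the renumbered graph -/
  F : ForestCert n (⇑ρ ∘ src) (⇑ρ ∘ tgt)

variable [DecidableEq Λ] [DecidableEq Υ] [Nonempty S]

/-- ★★ **«LOOP LINES BY THEIR SUP, TREE LINES BY THEIR LINE SUM, THE LAST VERTEX BY |□′|» — WITH THE CERTIFICATE ON A RENUMBERED COPY.**  Part Γ-a's
`graphValLS_le_of_forestCert` transported along `graphValLS_relabel`: the same bound for every `ForestCertR`. [cite: King1986, (3.66)–(3.70) p.664] -/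
theorem graphValLS_le_of_forestCertR {n : ℕ} {src tgt : Λ → Fin (n + 1)} (FR : ForestCertR n src tgt) (vtx : Υ → Fin (n + 1)) {ω : ℝ} (hω : 0 ≤ ω)
    (P : Λ → S → S → ℝ) (hP0 : ∀ ℓ x y, 0 ≤ P ℓ x y) (p : Υ → S → ℝ) (hp0 : ∀ υ x, 0 ≤ p υ x)
    (A : Λ → ℝ) (hA : ∀ ℓ, ℓ ∉ univ.image FR.F.tl → ∀ x y, P ℓ x y ≤ A ℓ)
    (c : Fin n → ℝ) (hc : ∀ i y, ∑ a, ω * P (FR.F.tl i) y a ≤ c i) (hc' : ∀ i y, ∑ a, ω * P (FR.F.tl i) a y ≤ c i)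
    (υ₀ : Υ) (hυ₀ : vtx υ₀ = 0) {Γ : ℝ} (hΓ : ∑ x, ω * p υ₀ x ≤ Γ)
    (q : Υ → ℝ) (hq : ∀ υ, υ ≠ υ₀ → ∀ x, p υ x ≤ q υ) :
    graphValLS ω src tgt P vtx p ≤ Γ * ((∏ ℓ ∈ (univ.image FR.F.tl)ᶜ, A ℓ) * (∏ i, c i) * ∏ υ ∈ univ.erase υ₀, q υ) := by
  rw [← graphValLS_relabel FR.ρ ω src tgt P vtx p]
  exact graphValLS_le_of_forestCert FR.F (⇑FR.ρ ∘ vtx) hω P hP0 p hp0 A hA c hc hc' υ₀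
    (by rw [Function.comp_apply, hυ₀, FR.ρ_zero]) hΓ q hq

end Relabel

end Summit.QuantumFields.YangMills.BalabanUVNodes.N15KingModelRung.Graph

namespace Summit.QuantumFields.YangMills.BalabanUVNodes.N15KingModelRung.Curved

open scoped BigOperators
open Finset
open Literature.MathematicalPhysics.QuantumFieldTheory.King1986.ContinuumLimit (eps)
open Summit.QuantumFields.YangMills.BalabanUVNodes.N15KingModelRung.Graph

variable (L : ℕ)

/-! ## §2 The abstract cores: a per-ordering majorisation by slice products ⇒ the bounds over all assignments -/

section Cores
variable {m : ℕ}

/-- ★★ **THE SIZE CORE**: if for every ordering `π` and every assignment `j` monotone along `π` a nonnegative quantity `G j` is majorised by `B·Π_p s_{j_{π p}}^{E^π_p}`,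
and every exponent list `E^π` (coarsest first) has positive partial degrees, then `Σ_j G j ≤ B·Σ_π degConst L E^π` — (3.58) + part Γ-b's monotone tuples +
part Ι-g's iterated (3.69)–(3.70); the graph enters only through the per-ordering majorisation. [cite: King1986, (3.58)–(3.59) p.663, (3.69)–(3.70) p.664] -/
theorem sum_le_of_perOrdering (hL : 2 ≤ L) {K : ℕ} (hK : 1 ≤ K) (G : (Fin m → Fin K) → ℝ) (hG0 : ∀ j, 0 ≤ G j) {B : ℝ} (hB0 : 0 ≤ B)
    (E : Equiv.Perm (Fin m) → Fin m → ℝ) (hper : ∀ (π : Equiv.Perm (Fin m)) (j : Fin m → Fin K), Monotone (j ∘ ⇑π) → G j ≤ B * sliceProd L K (E π) (j ∘ ⇑π))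
    (hpos : ∀ π, PosDegrees (List.ofFn fun p : Fin m => E π (Fin.rev p))) :
    ∑ j : Fin m → Fin K, G j ≤ B * ∑ π : Equiv.Perm (Fin m), degConst L (List.ofFn fun p : Fin m => E π (Fin.rev p)) := by
  classical
  refine (sum_le_sum_perm_monotone (β := Fin K) _ hG0).trans ?_
  have hdc : ∀ π : Equiv.Perm (Fin m),
      ∑ j : Fin m → Fin K, (if Monotone (j ∘ ⇑π) then G j else 0) ≤ B * degConst L (List.ofFn fun p : Fin m => E π (Fin.rev p)) := by
    intro π
    calc ∑ j : Fin m → Fin K, (if Monotone (j ∘ ⇑π) then G j else 0)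
        ≤ ∑ j : Fin m → Fin K, (if Monotone (j ∘ ⇑π) then B * sliceProd L K (E π) (j ∘ ⇑π) else 0) := by
          refine sum_le_sum fun j _ => ?_
          split_ifs with h
          · exact hper π j h
          · exact le_rfl
      _ = B * ∑ j : Fin m → Fin K, (if Monotone j then sliceProd L K (E π) j else 0) := by
          rw [mul_sum, ← sum_comp_perm_eq π (fun j : Fin m → Fin K => B * (if Monotone j then sliceProd L K (E π) j else 0))]
          refine sum_congr rfl fun j _ => ?_
          split_ifs <;> simp
      _ = B * nestedSliceSum L K (List.ofFn fun p : Fin m => E π (Fin.rev p)) (K - 1) := by rw [sum_monotone_sliceProd_eq_top L hK]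
      _ ≤ B * degConst L (List.ofFn fun p : Fin m => E π (Fin.rev p)) :=
          mul_le_mul_of_nonneg_left (nestedSliceSum_le_degConst L hL K (hpos π) (by omega)) hB0
  refine (sum_le_sum fun π _ => hdc π).trans (le_of_eq ?_)
  rw [← mul_sum]

/-- ★★ **THE `S^c` CORE**: under the same per-ordering majorisation, `γ ≥ 0`, `n₁ ≥ 1` and positive partial degrees of the FINEST-LOWERED lists, the sum over the
assignments with some line below `n₁` is at most `(L^{n₁−1}η)^γ·B·Σ_π degConst(lowered)` — part Γ-d's extraction, graph-free. [cite: King1986, (3.70) p.664] -/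
theorem sum_lt_le_of_perOrdering (hL : 2 ≤ L) {K : ℕ} (hK : 1 ≤ K) (G : (Fin m → Fin K) → ℝ) (hG0 : ∀ j, 0 ≤ G j) {B : ℝ} (hB0 : 0 ≤ B)
    (E : Equiv.Perm (Fin m) → Fin m → ℝ) (hper : ∀ (π : Equiv.Perm (Fin m)) (j : Fin m → Fin K), Monotone (j ∘ ⇑π) → G j ≤ B * sliceProd L K (E π) (j ∘ ⇑π))
    {γ : ℝ} (hγ : 0 ≤ γ) {n₁ : ℕ} (hn₁ : 1 ≤ n₁)
    (hpos : ∀ π, PosDegrees (List.ofFn fun p : Fin m => lowerFinest γ (E π) (Fin.rev p))) :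
    ∑ j : Fin m → Fin K, (if ∃ ℓ, ((j ℓ : ℕ)) < n₁ then G j else 0)
      ≤ ((L : ℝ) ^ (n₁ - 1) * eps L K) ^ γ * (B * ∑ π : Equiv.Perm (Fin m), degConst L (List.ofFn fun p : Fin m => lowerFinest γ (E π) (Fin.rev p))) := by
  classical
  have hL1 : 1 ≤ L := by omega
  have hL0 : (0 : ℝ) < L := by exact_mod_cast (show 0 < L by omega)
  set θ : ℝ := ((L : ℝ) ^ (n₁ - 1) * eps L K) ^ γ with hθ
  have hθ0 : 0 ≤ θ := Real.rpow_nonneg (by unfold eps; positivity) _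
  have hdc0 : ∀ π : Equiv.Perm (Fin m), 0 ≤ degConst L (List.ofFn fun p : Fin m => lowerFinest γ (E π) (Fin.rev p)) :=
    fun π => zero_le_one.trans (one_le_degConst L hL (hpos π))
  rcases Nat.eq_zero_or_pos m with hm0 | hm
  · subst hm0
    have h0 : ∀ j : Fin 0 → Fin K, ¬ ∃ ℓ, ((j ℓ : ℕ)) < n₁ := fun j ⟨ℓ, _⟩ => Fin.elim0 ℓ
    rw [sum_congr rfl fun j _ => if_neg (h0 j), sum_const_zero]
    exact mul_nonneg hθ0 (mul_nonneg hB0 (sum_nonneg fun π _ => hdc0 π))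
  have hsp0 : ∀ (π : Equiv.Perm (Fin m)) (j : Fin m → Fin K), 0 ≤ sliceProd L K (lowerFinest γ (E π)) (j ∘ ⇑π) := fun π j =>
    prod_nonneg fun p _ => Real.rpow_nonneg (by unfold eps; positivity) _
  have hper' : ∀ (π : Equiv.Perm (Fin m)) (j : Fin m → Fin K), Monotone (j ∘ ⇑π) → (∃ ℓ, ((j ℓ : ℕ)) < n₁) →
      G j ≤ θ * (B * sliceProd L K (lowerFinest γ (E π)) (j ∘ ⇑π)) := by
    intro π j hmono hex
    obtain ⟨ℓ, hℓ⟩ := hex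
    have h := hper π j hmono
    rw [sliceProd_eq_finest_mul L K hL1 hm γ] at h
    have hfin : ((L : ℝ) ^ (((j ∘ ⇑π) ⟨0, hm⟩ : ℕ)) * eps L K) ^ γ ≤ θ := by
      refine Real.rpow_le_rpow (by unfold eps; positivity) ?_ hγ
      refine mul_le_mul_of_nonneg_right (pow_le_pow_right₀ (by exact_mod_cast hL1) ?_) (by unfold eps; positivity)
      have h1 : ((j (π ⟨0, hm⟩) : ℕ)) ≤ (j ℓ : ℕ) := apply_perm_zero_le hm π j hmono ℓ
      show ((j (π ⟨0, hm⟩) : ℕ)) ≤ n₁ - 1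
      omega
    refine h.trans ?_
    calc B * (((L : ℝ) ^ (((j ∘ ⇑π) ⟨0, hm⟩ : ℕ)) * eps L K) ^ γ * sliceProd L K (lowerFinest γ (E π)) (j ∘ ⇑π))
        = ((L : ℝ) ^ (((j ∘ ⇑π) ⟨0, hm⟩ : ℕ)) * eps L K) ^ γ * (B * sliceProd L K (lowerFinest γ (E π)) (j ∘ ⇑π)) := by ring
      _ ≤ θ * (B * sliceProd L K (lowerFinest γ (E π)) (j ∘ ⇑π)) := mul_le_mul_of_nonneg_right hfin (mul_nonneg hB0 (hsp0 π j))
  have hF0 : ∀ j : Fin m → Fin K, 0 ≤ (if ∃ ℓ, ((j ℓ : ℕ)) < n₁ then G j else 0) := fun j => by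
    split_ifs
    · exact hG0 j
    · exact le_rfl
  refine (sum_le_sum_perm_monotone (β := Fin K) _ hF0).trans ?_
  have hdc : ∀ π : Equiv.Perm (Fin m),
      ∑ j : Fin m → Fin K, (if Monotone (j ∘ ⇑π) then (if ∃ ℓ, ((j ℓ : ℕ)) < n₁ then G j else 0) else 0)
        ≤ θ * (B * degConst L (List.ofFn fun p : Fin m => lowerFinest γ (E π) (Fin.rev p))) := by
    intro π
    calc ∑ j : Fin m → Fin K, (if Monotone (j ∘ ⇑π) then (if ∃ ℓ, ((j ℓ : ℕ)) < n₁ then G j else 0) else 0)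
        ≤ ∑ j : Fin m → Fin K, (if Monotone (j ∘ ⇑π) then θ * (B * sliceProd L K (lowerFinest γ (E π)) (j ∘ ⇑π)) else 0) := by
          refine sum_le_sum fun j _ => ?_
          split_ifs with h1 h2
          · exact hper' π j h1 h2
          · exact mul_nonneg hθ0 (mul_nonneg hB0 (hsp0 π j))
          · exact le_rfl
      _ = θ * (B * ∑ j : Fin m → Fin K, (if Monotone j then sliceProd L K (lowerFinest γ (E π)) j else 0)) := by
          rw [mul_sum, mul_sum, ← sum_comp_perm_eq π (fun j : Fin m → Fin K =>
            θ * (B * (if Monotone j then sliceProd L K (lowerFinest γ (E π)) j else 0)))]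
          refine sum_congr rfl fun j _ => ?_
          split_ifs <;> simp
      _ = θ * (B * nestedSliceSum L K (List.ofFn fun p : Fin m => lowerFinest γ (E π) (Fin.rev p)) (K - 1)) := by
          rw [sum_monotone_sliceProd_eq_top L hK]
      _ ≤ θ * (B * degConst L (List.ofFn fun p : Fin m => lowerFinest γ (E π) (Fin.rev p))) :=
          mul_le_mul_of_nonneg_left (mul_le_mul_of_nonneg_left (nestedSliceSum_le_degConst L hL K (hpos π) (by omega)) hB0) hθ0
  refine (sum_le_sum fun π _ => hdc π).trans (le_of_eq ?_)
  rw [← mul_sum, ← mul_sum]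

end Cores

/-! ## §3 The generic assemblies with RELABELLED certificates (one renumbering per ordering) -/

section AssemblyR
variable {S : Type*} [Fintype S] [Nonempty S] {Υ : Type*} [Fintype Υ] [DecidableEq Υ]
variable {n m : ℕ} {src tgt : Fin m → Fin (n + 1)}

/-- ★★★ **THE GENERIC SIZE HALF WITH ONE RENUMBERING PER ORDERING** — part Γ-b `sum_graphValLS_slices_le` for certificates `cert π : ForestCertR` (King's
elimination order differs from ordering to ordering): `Σ_j 𝔼(H(j)) ≤ Γ·Cst^m·cV^n·(Σ_π degConst L (orderList … π (cert π).F))·Π_{υ≠υ₀} q_υ`.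
[cite: King1986, (3.58)–(3.59) p.663, (3.66)–(3.70) p.664] -/
theorem sum_graphValLS_slices_le_R (hL : 2 ≤ L) {K : ℕ} (hK : 1 ≤ K) (vtx : Υ → Fin (n + 1)) {ω : ℝ} (hω : 0 ≤ ω)
    (P : Fin m → Fin K → S → S → ℝ) (hP0 : ∀ ℓ c x y, 0 ≤ P ℓ c x y) {Cst cV : ℝ} (hCst : 0 ≤ Cst) (hcV : 0 ≤ cV) (dV : ℝ) (e : Fin m → ℝ)
    (hsup : ∀ ℓ c x y, P ℓ c x y ≤ Cst * ((L : ℝ) ^ ((c : ℕ)) * eps L K) ^ e ℓ)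
    (hrow : ∀ ℓ c y, ∑ a, ω * P ℓ c y a ≤ Cst * cV * ((L : ℝ) ^ ((c : ℕ)) * eps L K) ^ (e ℓ + dV))
    (hcol : ∀ ℓ c y, ∑ a, ω * P ℓ c a y ≤ Cst * cV * ((L : ℝ) ^ ((c : ℕ)) * eps L K) ^ (e ℓ + dV))
    (p : Υ → S → ℝ) (hp0 : ∀ υ x, 0 ≤ p υ x) (υ₀ : Υ) (hυ₀ : vtx υ₀ = 0) {Γ : ℝ} (hΓ : ∑ x, ω * p υ₀ x ≤ Γ)
    (q : Υ → ℝ) (hq : ∀ υ, υ ≠ υ₀ → ∀ x, p υ x ≤ q υ)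
    (cert : Equiv.Perm (Fin m) → ForestCertR n src tgt) (hpos : ∀ π, PosDegrees (orderList dV e π (cert π).F)) :
    ∑ j : Fin m → Fin K, graphValLS ω src tgt (fun ℓ => P ℓ (j ℓ)) vtx p
      ≤ Γ * (Cst ^ m * cV ^ n * (∑ π : Equiv.Perm (Fin m), degConst L (orderList dV e π (cert π).F)) * ∏ υ ∈ univ.erase υ₀, q υ) := by
  classical
  obtain ⟨x₀⟩ := ‹Nonempty S›
  have hΓ0 : 0 ≤ Γ := (sum_nonneg fun x _ => mul_nonneg hω (hp0 _ _)).trans hΓ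
  have hq0 : 0 ≤ ∏ υ ∈ univ.erase υ₀, q υ := prod_nonneg fun υ hυ => (hp0 υ x₀).trans (hq υ (ne_of_mem_erase hυ) x₀)
  have hB0 : 0 ≤ Γ * (Cst ^ m * cV ^ n * ∏ υ ∈ univ.erase υ₀, q υ) :=
    mul_nonneg hΓ0 (mul_nonneg (mul_nonneg (pow_nonneg hCst _) (pow_nonneg hcV _)) hq0)
  have h := sum_le_of_perOrdering L hL hK (fun j => graphValLS ω src tgt (fun ℓ => P ℓ (j ℓ)) vtx p)
    (fun j => graphValLS_nonneg' src tgt vtx hω _ (fun ℓ => hP0 ℓ _) p hp0) hB0 (fun π => orderExps dV e π (cert π).F)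
    (fun π j _ => by
      have h := graphValLS_le_of_forestCertR (cert π) vtx hω (fun ℓ => P ℓ (j ℓ)) (fun ℓ => hP0 ℓ _) p hp0
        (fun ℓ => Cst * ((L : ℝ) ^ ((j ℓ : ℕ)) * eps L K) ^ e ℓ) (fun ℓ _ x y => hsup ℓ _ x y)
        (fun i => Cst * cV * ((L : ℝ) ^ ((j ((cert π).F.tl i) : ℕ)) * eps L K) ^ (e ((cert π).F.tl i) + dV))
        (fun i y => hrow _ _ y) (fun i y => hcol _ _ y) υ₀ hυ₀ hΓ q hq
      rw [lineConstants_eq L K (cert π).F π Cst cV dV e j] at h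
      refine h.trans (le_of_eq ?_)
      ring)
    hpos
  refine h.trans (le_of_eq ?_)
  unfold orderList
  ring

/-- ★★ **THE `S^c` TERMS WITH ONE RENUMBERING PER ORDERING** — part Γ-d `sum_graphValLS_slices_lt_le` for `ForestCertR`. [cite: King1986, (3.70) p.664] -/
theorem sum_graphValLS_slices_lt_le_R (hL : 2 ≤ L) {K : ℕ} (hK : 1 ≤ K) (vtx : Υ → Fin (n + 1)) {ω : ℝ} (hω : 0 ≤ ω)
    (P : Fin m → Fin K → S → S → ℝ) (hP0 : ∀ ℓ c x y, 0 ≤ P ℓ c x y) {Cst cV : ℝ} (hCst : 0 ≤ Cst) (hcV : 0 ≤ cV) (dV : ℝ) (e : Fin m → ℝ)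
    (hsup : ∀ ℓ c x y, P ℓ c x y ≤ Cst * ((L : ℝ) ^ ((c : ℕ)) * eps L K) ^ e ℓ)
    (hrow : ∀ ℓ c y, ∑ a, ω * P ℓ c y a ≤ Cst * cV * ((L : ℝ) ^ ((c : ℕ)) * eps L K) ^ (e ℓ + dV))
    (hcol : ∀ ℓ c y, ∑ a, ω * P ℓ c a y ≤ Cst * cV * ((L : ℝ) ^ ((c : ℕ)) * eps L K) ^ (e ℓ + dV))
    (p : Υ → S → ℝ) (hp0 : ∀ υ x, 0 ≤ p υ x) (υ₀ : Υ) (hυ₀ : vtx υ₀ = 0) {Γ : ℝ} (hΓ : ∑ x, ω * p υ₀ x ≤ Γ)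
    (q : Υ → ℝ) (hq : ∀ υ, υ ≠ υ₀ → ∀ x, p υ x ≤ q υ)
    (cert : Equiv.Perm (Fin m) → ForestCertR n src tgt) {γ : ℝ} (hγ : 0 ≤ γ) {n₁ : ℕ} (hn₁ : 1 ≤ n₁)
    (hpos : ∀ π, PosDegrees (List.ofFn fun p : Fin m => lowerFinest γ (orderExps dV e π (cert π).F) (Fin.rev p))) :
    ∑ j : Fin m → Fin K, (if ∃ ℓ, ((j ℓ : ℕ)) < n₁ then graphValLS ω src tgt (fun ℓ => P ℓ (j ℓ)) vtx p else 0)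
      ≤ ((L : ℝ) ^ (n₁ - 1) * eps L K) ^ γ * (Γ * (Cst ^ m * cV ^ n
          * (∑ π : Equiv.Perm (Fin m), degConst L (List.ofFn fun p : Fin m => lowerFinest γ (orderExps dV e π (cert π).F) (Fin.rev p)))
          * ∏ υ ∈ univ.erase υ₀, q υ)) := by
  classical
  obtain ⟨x₀⟩ := ‹Nonempty S›
  have hΓ0 : 0 ≤ Γ := (sum_nonneg fun x _ => mul_nonneg hω (hp0 _ _)).trans hΓ
  have hq0 : 0 ≤ ∏ υ ∈ univ.erase υ₀, q υ := prod_nonneg fun υ hυ => (hp0 υ x₀).trans (hq υ (ne_of_mem_erase hυ) x₀)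
  have hB0 : 0 ≤ Γ * (Cst ^ m * cV ^ n * ∏ υ ∈ univ.erase υ₀, q υ) :=
    mul_nonneg hΓ0 (mul_nonneg (mul_nonneg (pow_nonneg hCst _) (pow_nonneg hcV _)) hq0)
  have h := sum_lt_le_of_perOrdering L hL hK (fun j => graphValLS ω src tgt (fun ℓ => P ℓ (j ℓ)) vtx p)
    (fun j => graphValLS_nonneg' src tgt vtx hω _ (fun ℓ => hP0 ℓ _) p hp0) hB0 (fun π => orderExps dV e π (cert π).F)
    (fun π j _ => by
      have h := graphValLS_le_of_forestCertR (cert π) vtx hω (fun ℓ => P ℓ (j ℓ)) (fun ℓ => hP0 ℓ _) p hp0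
        (fun ℓ => Cst * ((L : ℝ) ^ ((j ℓ : ℕ)) * eps L K) ^ e ℓ) (fun ℓ _ x y => hsup ℓ _ x y)
        (fun i => Cst * cV * ((L : ℝ) ^ ((j ((cert π).F.tl i) : ℕ)) * eps L K) ^ (e ((cert π).F.tl i) + dV))
        (fun i y => hrow _ _ y) (fun i y => hcol _ _ y) υ₀ hυ₀ hΓ q hq
      rw [lineConstants_eq L K (cert π).F π Cst cV dV e j] at h
      refine h.trans (le_of_eq ?_)
      ring)
    hγ hn₁ hpos
  refine h.trans (le_of_eq ?_)
  ring

end AssemblyR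

end Summit.QuantumFields.YangMills.BalabanUVNodes.N15KingModelRung.Curved

end
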